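import Mathlib
import HarnessLib
import Literature.Probability.LatticeModels.LatticeGraph
import Summits.HubbardSuperconductivity.HubbardSuperconductivity.Theorems.BalabanIRBirComplexStableXYFixedVolumeLaplace
import Summits.HubbardSuperconductivity.HubbardSuperconductivity.Theorems.BalabanIRBirComplexStableXYFixedVolumeGaussCompact
import Summits.HubbardSuperconductivity.HubbardSuperconductivity.Theorems.BalabanIRBirComplexStableXYFixedVolumeUniformBounds
import Summits.HubbardSuperconductivity.HubbardSuperconductivity.Theorems.BalabanIRBirComplexStableXYFixedVolumeUniformCore

/-!
# BalabanIR engine `BirComplexStableXY` (stmt-HubbardSuperconductivity-2080): fixed-volume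
stability UNIFORM over the admissible class

Support theorem for crux 2 of route BalabanIR (`--supports stmt-HubbardSuperconductivity-2080`),
the sharp form of the fixed-volume analysis: the threshold `K₁` depends only on
`(r, B, c₀, L, M)`, i.e. it is UNIFORM over all Fourier tables `c` satisfying (U1), (N), (A), (C):

  `birFixedVolume_uniform_stable`:
  `∀ r ≥ 2, ∀ B, ∀ c₀ > 0, ∀ L M ≥ 1, ∃ K₁, ∀ K ≥ K₁, ∀ c admissible, Z ≠ 0 ∧ 1/2 ≤ Re (∫ O e^{-A}/Z)`

for the objects exactly as typed in `Theses.BalabanIR.BirComplexStableXY` (same `sh`, `F`, `A`,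
`cube`, `Z`, `O`).  Compared with the crux, ONLY the order of `∃ K₀` and `∀ L M` is exchanged
(and the vacuous `L₀` dropped): the typed engine claim is precisely the assertion that this
`K₁(r, B, c₀, L, M)` can be taken independent of `(L, M)` — which is where the
Beraha–Kahane–Weiss zeros of the refuter record (`M ~ K² L⁴`) say it fails.

Proof: `birUnif_core` (the `O(1/√K)` Laplace rate with constants uniform in `c`) with the
`c`-independent coercivity constant of `birUnif_coercive` and the uniform Gaussian lower bound
`birGauss_uniform_lower_bound`.  No definitions.
-/

namespace Summit.HubbardSuperconductivity.HubbardSuperconductivity.Theorems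

open scoped BigOperators
open MeasureTheory Set Complex Filter Topology Literature.Probability.LatticeModels

section UniformStable

variable {r : ℕ} {L M : ℕ} [NeZero L] [NeZero M]

/-- **Uniform fixed-volume stability, parametrised form.**  For `r ≥ 2`, any budget `B` and
`c₀ > 0`, and sizes `L, M ≥ 1`, there is `K₁` such that for ALL `K ≥ K₁` and ALL Fourier tables
`c` with (U1), (N), (A), (C) (with `F`, `sh`, `O` given by their defining equations) the
partition function over `[0,2π]^Λ` is non-zero and the slice order is at least `1/2`. -/
theorem birFixedVolume_uniform_stable_of (hr : 2 ≤ r) (B : ℝ) {c₀ : ℝ} (hc₀ : 0 < c₀) :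
    ∃ K₁ : ℝ, ∀ K : ℝ, K₁ ≤ K →
      ∀ (c : ((Fin r × Fin r × Fin r) → ℤ) →₀ ℂ)
        (F : ((Fin r × Fin r × Fin r) → ℝ) → ℂ),
        (∀ φ, F φ = c.sum (fun n a => a * cexp (I * ((∑ w, (n w : ℝ) * φ w : ℝ) : ℂ)))) →
      ∀ (sh : (TorusSite 2 L × ZMod M) → (Fin r × Fin r × Fin r) → (TorusSite 2 L × ZMod M)),
        (∀ s w, sh s w = (s.1 + ![((w.1 : ℕ) : ZMod L), ((w.2.1 : ℕ) : ZMod L)],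
          s.2 + ((w.2.2 : ℕ) : ZMod M))) →
      ∀ (O : ((TorusSite 2 L × ZMod M) → ℝ) → ℝ),
        (∀ θ, O θ = ‖∑ x : TorusSite 2 L, cexp (I * (θ (x, 0) : ℂ))‖ ^ 2 / (L : ℝ) ^ 4) →
      (∀ n ∈ c.support, ∑ w, n w = 0) → c.sum (fun _ a => a) = 0 →
      c.sum (fun n a => ‖a‖ * Real.exp (∑ w, |(n w : ℝ)|)) ≤ B →
      (∀ φ : (Fin r × Fin r × Fin r) → ℝ,
        c₀ * ∑ w, ∑ w', (1 - Real.cos (φ w - φ w')) ≤ (F φ).re) →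
      (∫ θ in Set.pi univ (fun _ : TorusSite 2 L × ZMod M => Icc (0 : ℝ) (2 * Real.pi)),
          cexp (-((K : ℂ) * ∑ s, F (fun w => θ (sh s w))))) ≠ 0 ∧
      (1 / 2 : ℝ) ≤ ((∫ θ in Set.pi univ (fun _ : TorusSite 2 L × ZMod M => Icc (0 : ℝ) (2 * Real.pi)),
          ((O θ : ℝ) : ℂ) * cexp (-((K : ℂ) * ∑ s, F (fun w => θ (sh s w))))) /
        (∫ θ in Set.pi univ (fun _ : TorusSite 2 L × ZMod M => Icc (0 : ℝ) (2 * Real.pi)),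
          cexp (-((K : ℂ) * ∑ s, F (fun w => θ (sh s w)))))).re := by
  set s₀ : TorusSite 2 L × ZMod M := 0 with hs₀
  obtain ⟨m, hm, hcoerU⟩ := birUnif_coercive (L := L) (M := M) hr hc₀ s₀
  obtain ⟨g₀, hg₀, hGlow⟩ := birGauss_uniform_lower_bound (ι := {i // i ≠ s₀})
    (2 * Fintype.card (TorusSite 2 L × ZMod M) * max B 0) hm
  set Mg : ℝ := ∫ u : {i // i ≠ s₀} → ℝ, Real.exp (-(m / 2) * ∑ i, u i ^ 2) with hMg
  have hMg0 : 0 ≤ Mg := integral_nonneg fun u => (Real.exp_pos _).le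
  have hB'0 : 0 ≤ max B 0 := le_max_right _ _
  set AZ : ℝ := (0 * ((1 + 2 / m) / 2) + 1 * (Fintype.card (TorusSite 2 L × ZMod M) * max B 0)
        * ((2 / m) * (1 + 4 / m)) + 2 * 1 / (m * Real.pi ^ 2)) * Mg with hAZ
  set AN : ℝ := (2 * ((1 + 2 / m) / 2) + 1 * (Fintype.card (TorusSite 2 L × ZMod M) * max B 0)
        * ((2 / m) * (1 + 4 / m)) + 2 * 1 / (m * Real.pi ^ 2)) * Mg with hAN
  have hAZ0 : 0 ≤ AZ := by positivity
  have hAN0 : 0 ≤ AN := by positivity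
  set x : ℝ := 8 * (AZ + AN + 1) / g₀ with hx
  have hx0 : 0 ≤ x := by positivity
  refine ⟨max 1 (x ^ 2), fun K hK c F hF sh hsh O hO hU1 hN hA hC => ?_⟩
  have hK1 : 1 ≤ K := le_trans (le_max_left _ _) hK
  have hKx : x ^ 2 ≤ K := le_trans (le_max_right _ _) hK
  have hsK : 0 < Real.sqrt K := Real.sqrt_pos.2 (by linarith)
  have hxs : x ≤ Real.sqrt K := by
    calc x = Real.sqrt (x ^ 2) := (Real.sqrt_sq hx0).symm
      _ ≤ Real.sqrt K := Real.sqrt_le_sqrt hKx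
  have hkey : AZ + AN + 1 ≤ g₀ / 8 * Real.sqrt K := by
    calc AZ + AN + 1 = g₀ / 8 * x := by rw [hx]; field_simp
      _ ≤ g₀ / 8 * Real.sqrt K := mul_le_mul_of_nonneg_left hxs (by positivity)
  have hεZ : AZ / Real.sqrt K ≤ g₀ / 8 := by
    rw [div_le_iff₀ hsK]; linarith
  have hεN : AN / Real.sqrt K ≤ g₀ / 8 := by
    rw [div_le_iff₀ hsK]; linarith
  exact birUnif_core c hU1 hN hA hF hsh hO hm (hcoerU c F hF hC sh hsh) hg₀ hGlow hK1 hεZ hεN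

/-- **Fixed-volume stability of the typed engine class, uniform over the admissible class**
(only `∃ K₀` and `∀ L M` exchanged with respect to `BirComplexStableXY`).  For `r ≥ 2`, any
budget `B`, `c₀ > 0` and sizes `L, M ≥ 1` there is `K₁` such that for all `K ≥ K₁` and ALL
Fourier tables `c` satisfying (U1), (N), (A), (C), the typed partition function is non-zero
and the typed slice order is at least `1/2`.  The `let`s are verbatim those of the route
statement. -/
theorem birFixedVolume_uniform_stable (r : ℕ) (B c₀ : ℝ) (hr : 2 ≤ r) (hc₀ : 0 < c₀)
    (L M : ℕ) [NeZero L] [NeZero M] :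
    ∃ K₁ : ℝ, ∀ K : ℝ, K₁ ≤ K →
    ∀ c : ((Fin r × Fin r × Fin r) → ℤ) →₀ ℂ,
    (∀ n ∈ c.support, ∑ w, n w = 0) → c.sum (fun _ a => a) = 0 →
    c.sum (fun n a => ‖a‖ * Real.exp (∑ w, |(n w : ℝ)|)) ≤ B →
    (∀ φ : (Fin r × Fin r × Fin r) → ℝ, c₀ * ∑ w, ∑ w', (1 - Real.cos (φ w - φ w')) ≤
      ((fun (φ : (Fin r × Fin r × Fin r) → ℝ) => c.sum (fun n a => a * Complex.exp (Complex.I *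
        ((∑ w, (n w : ℝ) * φ w : ℝ) : ℂ)))) φ).re) →
    let sh : (TorusSite 2 L × ZMod M) → (Fin r × Fin r × Fin r) → (TorusSite 2 L × ZMod M) :=
      fun s w => (s.1 + ![((w.1 : ℕ) : ZMod L), ((w.2.1 : ℕ) : ZMod L)], s.2 + ((w.2.2 : ℕ) : ZMod M))
    let F : ((Fin r × Fin r × Fin r) → ℝ) → ℂ := fun (φ : (Fin r × Fin r × Fin r) → ℝ) =>
      c.sum (fun n a => a * Complex.exp (Complex.I * ((∑ w, (n w : ℝ) * φ w : ℝ) : ℂ)))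
    let A : ((TorusSite 2 L × ZMod M) → ℝ) → ℂ := fun θ => (K : ℂ) * ∑ s, F (fun w => θ (sh s w))
    let cube : Set ((TorusSite 2 L × ZMod M) → ℝ) :=
      Set.pi Set.univ (fun _ => Set.Icc (0:ℝ) (2 * Real.pi))
    let Z : ℂ := MeasureTheory.integral (MeasureTheory.volume.restrict cube)
      (fun θ => Complex.exp (-(A θ)))
    let O : ((TorusSite 2 L × ZMod M) → ℝ) → ℝ := fun θ =>
      ‖∑ x : TorusSite 2 L, Complex.exp (Complex.I * (θ (x, 0) : ℂ))‖ ^ 2 / (L : ℝ) ^ 4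
    Z ≠ 0 ∧ (1/2 : ℝ) ≤ ((MeasureTheory.integral (MeasureTheory.volume.restrict cube)
      (fun θ => (O θ : ℂ) * Complex.exp (-(A θ)))) / Z).re := by
  obtain ⟨K₁, hK₁⟩ := birFixedVolume_uniform_stable_of (L := L) (M := M) hr B hc₀
  refine ⟨K₁, fun K hK c hU1 hN hA hC => ?_⟩
  dsimp only
  exact hK₁ K hK c _ (fun _ => rfl) _ (fun _ _ => rfl) _ (fun _ => rfl) hU1 hN hA hC

end UniformStable

end Summit.HubbardSuperconductivity.HubbardSuperconductivity.Theorems
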